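import Literature.Probability.RandomPlanarGeometry.HexSAWPolygonCellsHosts
import Literature.Probability.RandomPlanarGeometry.HexSAWPolygonCellsPeel
import HarnessLib

/-!
# Cell calculus for honeycomb polygon surgery, VII: HOST TRANSFER under peeling a spike (CLAIM H)

Topic `Literature/Probability/RandomPlanarGeometry` (lane «pcv-sawmu», a-p4 g21; sequel of `HexSAWPolygonCellsHosts.lean` (`IsHost`) and
`HexSAWPolygonCellsPeel.lean` (`IsSpikeTop`, `peel`)).

CLAIM H of `HOME/pub-sawmu-a-p4/g21/omega/THEOREM-OMEGA-g21.md` §3: if the top hexagon `m` of `S` is an up-right spike on `d = LL m`, then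
(i) `d` is a host of `S ∖ m` (`isHost_erase_ll_of_isSpikeTop`) — this is how the recursion of «OMEGA» re-attaches `m` at `port d` —, and
(ii) the hosts of `S` other than `m` are exactly the hosts `d'` of `S ∖ m` with `UR d'` above `m` (`isHost_iff_isHost_erase`); in particular they
are hosts of `S ∖ m` (`IsHost.erase_of_ne`).  Together with `peel` this identifies the supports of all peeled spikes as hosts of the base or
previously peeled spikes (the stick structure of LEMMA D, sequel).

Sources: N. Madras, G. Slade, *The Self-Avoiding Walk* (1993), §3.2, proof of Theorem 3.2.3 [MadrasSlade1993]; I. Jensen, J. Phys.: Conf.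
Ser. 42 (2006) 163 [Jensen2006HoneycombPolygons].  Label (lane): LANE INFRASTRUCTURE; nothing new in writing.
-/

open Finset

namespace Literature.Probability.RandomPlanarGeometry.SAW

namespace HexCell

/-- For a spike top `m`, `LL m ∈ S` and the other five neighbours of `m` are outside `S`. [cite: MadrasSlade1993, §3.2 (proof of Theorem 3.2.3)] -/
theorem IsSpikeTop.ll_mem {S : Finset Cell} {m : Cell} (h : IsSpikeTop S m) : LL m ∈ S := by
  have : LL m ∈ nbrs m ∩ S := by rw [h.2]; exact mem_singleton_self _
  exact (mem_inter.1 this).2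

/-- For a spike top `m`, a neighbour of `m` in `S` is `LL m`. [cite: MadrasSlade1993, §3.2 (proof of Theorem 3.2.3)] -/
theorem IsSpikeTop.eq_ll_of_mem {S : Finset Cell} {m c : Cell} (h : IsSpikeTop S m) (hc : c ∈ nbrs m) (hcS : c ∈ S) : c = LL m := by
  have : c ∈ nbrs m ∩ S := mem_inter.2 ⟨hc, hcS⟩
  rw [h.2] at this
  exact mem_singleton.1 this

/-- ★ **(i) The support of a peeled spike is a host of the rest**: if `m` is a spike top of `S` then `LL m` is a host of `S.erase m`
(`R (LL m) = LR m ∉ S`, `UL (LL m) = L m ∉ S`, and `UR (LL m) = m` is above everything else).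
[cite: MadrasSlade1993, §3.2 (proof of Theorem 3.2.3: removing and re-attaching the extremal unit)] -/
theorem isHost_erase_ll_of_isSpikeTop {S : Finset Cell} {m : Cell} (h : IsSpikeTop S m) : IsHost (S.erase m) (LL m) := by
  obtain ⟨a, b⟩ := m
  have hlex := h.1
  refine ⟨?_, ?_, ?_, ?_⟩
  · exact mem_erase.2 ⟨by intro e; have := congrArg Prod.snd e; simp at this, h.ll_mem⟩
  · -- R (LL m) = LR m
    intro hm
    have hm' := (mem_erase.1 hm).2
    have e : R (LL (a, b)) = LR (a, b) := by ext <;> simp; ring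
    rw [e] at hm'
    have := h.eq_ll_of_mem (by simp [mem_nbrs_iff, LR]) hm'
    have := congrArg Prod.fst this; simp at this; omega
  · -- UL (LL m) = L m
    intro hm
    have hm' := (mem_erase.1 hm).2
    have e : UL (LL (a, b)) = L (a, b) := by ext <;> simp; ring
    rw [e] at hm'
    have := h.eq_ll_of_mem (by simp [mem_nbrs_iff, L]) hm'
    have := congrArg Prod.snd this; simp at this; omega
  · intro c hc
    have hc' := (mem_erase.1 hc)
    rcases hlex.2 c hc'.2 with h1 | ⟨h1, h2⟩
    · left; simp; omega
    · -- same row as `m`, `c.x ≤ a`, and `c ≠ m`; parity is not needed: `c.x < a + … ` suffices as `c.x ≤ a` and `c ≠ m`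
      rcases lt_or_eq_of_le h2 with h3 | h3
      · right; simp; omega
      · exfalso; apply hc'.1; ext <;> simp <;> omega

/-- ★ **(ii) Host transfer**: for `d ≠ m`, `d` is a host of `S` iff it is a host of `S.erase m` with `UR d` above `m`.
[cite: MadrasSlade1993, §3.2 (proof of Theorem 3.2.3)] -/
theorem isHost_iff_isHost_erase {S : Finset Cell} {m d : Cell} (h : IsSpikeTop S m) (hne : d ≠ m) :
    IsHost S d ↔ IsHost (S.erase m) d ∧ (m.2 < d.2 + 1 ∨ (m.2 = d.2 + 1 ∧ m.1 < d.1 + 1)) := by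
  have hmS : m ∈ S := h.1.1
  constructor
  · rintro ⟨hd, hR, hUL, htop⟩
    refine ⟨⟨mem_erase.2 ⟨hne, hd⟩, fun hx => hR (mem_erase.1 hx).2, fun hx => hUL (mem_erase.1 hx).2,
      fun c hc => htop c (mem_erase.1 hc).2⟩, htop m hmS⟩
  · rintro ⟨⟨hd, hR, hUL, htop⟩, hm⟩
    have hdS := (mem_erase.1 hd).2
    refine ⟨hdS, fun hx => ?_, fun hx => ?_, fun c hc => ?_⟩
    · -- `R d ∈ S` would force `R d = m` (it is not in `S.erase m`); but then `d = L m` is a neighbour of `m` in `S` other than `LL m`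
      have e : R d = m := by
        by_contra hx'; exact hR (mem_erase.2 ⟨hx', hx⟩)
      have : d ∈ nbrs m := by
        rw [← e]; obtain ⟨x, y⟩ := d; simp [mem_nbrs_iff, R]
      have hdl := h.eq_ll_of_mem this hdS
      rw [← e] at hdl
      obtain ⟨x, y⟩ := d
      have := congrArg Prod.snd hdl; simp [R, LL] at this; omega
    · have e : UL d = m := by
        by_contra hx'; exact hUL (mem_erase.2 ⟨hx', hx⟩)
      have : d ∈ nbrs m := by
        rw [← e]; obtain ⟨x, y⟩ := d; simp [mem_nbrs_iff, UL]
      have hdl := h.eq_ll_of_mem this hdS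
      rw [← e] at hdl
      obtain ⟨x, y⟩ := d
      have := congrArg Prod.fst hdl; simp [UL, LL] at this; omega
    · by_cases hcm : c = m
      · subst hcm; exact hm
      · exact htop c (mem_erase.2 ⟨hcm, hc⟩)

/-- Hosts of `S` other than the spike top remain hosts after peeling it. [cite: MadrasSlade1993, §3.2 (proof of Theorem 3.2.3)] -/
theorem IsHost.erase_of_ne {S : Finset Cell} {m d : Cell} (h : IsSpikeTop S m) (hd : IsHost S d) (hne : d ≠ m) :
    IsHost (S.erase m) d :=
  ((isHost_iff_isHost_erase h hne).1 hd).1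

/-- The spike top itself is a host of `S` (as is every top hexagon) — the port of the NEXT spike stacked on it.
[cite: MadrasSlade1993, §3.2 (proof of Theorem 3.2.3)] -/
theorem IsSpikeTop.isHost {S : Finset Cell} {m : Cell} (h : IsSpikeTop S m) : IsHost S m := h.1.isHost

end HexCell

end Literature.Probability.RandomPlanarGeometry.SAW
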